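import Summits.BirchSwinnertonDyer.BirchSwinnertonDyer.Theorems.KatoDescentPotSupersingularFineSelmerControlFineMordellWeil
import Literature.NumberTheory.EllipticCurves.SubgroupSelmerProofs
import Literature.NumberTheory.EllipticCurves.SelmerCorankProofs
import Literature.NumberTheory.EllipticCurves.KramerShaIsogeny
import HarnessLib

/-!
# The fine control theorem with the FINE MORDELL–WEIL hypothesis — PART 2, the RANK-ONE Kummer discharge
# (`fineMordellWeil_of_rankOne`, `fineSelmerInfty_eq_bot_of_rankOne`, `conjA_[rat_]of_rankOne`): `Sel₀(K_∞, E[p^∞]) = 0`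
# for anchors of rank ONE; sequel of `…FineSelmerControlFineMordellWeil` (p-landed by k8t-c2 g9, the (FMW) control part);
# split by the courtesy-landing seat k8t-c4 g7 to respect the 400-line rule — decls VERBATIM from conjA-anchor g3's v2 file
# (sha16 99e03670d6ac4e1a, sections RankOneTools / RankOne / RankOneConjA / RankOneRat) (route `KatoDescentPotSupersingular` / `KatoDescentTamePotSupersingular`, rungs K9 / K8-t′, cell
# `bsd-potss`; items stmt-BirchSwinnertonDyer-19386 / 19413; a `--supports … --as helper` file; seat
# `bsd-potss-conjA-anchor` g3 (census seat; courtesy landing by a prover seat); ROUTE-FREE; nothing booked,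
# BSD is not proved by any of this)

WHY. k9-c4 g6's fine control theorem (`fineSelmerInfty_eq_bot_of_natCard_selmerGroupPInfty_eq_one[_of_local]`,
p479853: Greenberg's Prop. 3.8 for the FINE Selmer group) assumes `#Sel_{p^∞}(E/K) = 1`, i.e. a RANK-ZERO
anchor with `Ш[p^∞] = 0`. Its proof shows more: a `Γ`-fixed fine class over `K_∞` is `h_0(y)` for a class
`y ∈ Sel_{p^∞}(E/K)` which is moreover LOCALLY TRIVIAL at every place of `S` carrying the torsion socket —
in particular at every `v ∣ p`. Hence the global input can be weakened to the FINE MORDELL–WEIL hypothesis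

  (FMW) every `y ∈ Sel_{p^∞}(E/K)` that vanishes on `D_v` for all `v ∈ S`, `v ∣ p`, is zero,

which holds for rank-`0` anchors with `Ш[p^∞] = 0` (g6's case) AND for rank-ONE anchors with `Ш[p^∞] = 0`
whose generator is not `p`-divisible in `E(K_v)` for one `v ∣ p` in `S` (Kummer theory: `Sel_{p^∞}(E/K) =
κ(E(K) ⊗ ℚ_p/ℤ_p)` when `Ш[p^∞] = 0`, and a Kummer class `κ_N(nP)` vanishing on `D_v` forces a `D_v`-fixed
`p`-th root of `P` unless it is zero) — sections `RankOneTools` / `RankOne` / `RankOneConjA` below DISCHARGE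
(FMW) from such rank-one data (`fineMordellWeil_of_rankOne`, `fineSelmerInfty_eq_bot_of_rankOne`,
`conjA_of_rankOne`, `conjA_rat_of_rankOne`), using the tree's Kummer theory (`SelmerCorankProofs`:
`kummerMapLevel`, `range_kummerMapPInfty`, `map_primaryH1ToH1_selmerGroupPInfty`) and the explicit bridge
`H¹(Γ_K, ·) ≃ H¹(⊤, ·)` of `SubgroupSelmerProofs`. The congruence-anchor census of this seat
(`RANK1-ANCHORS-conjA-anchor-g3.tsv`) finds 75 rows of the two Conj-A cruxes (61 of them ♯) without a rank-0
kernel road whose BSD-known congruent partners (conductor `< 5000`, or CM) have rank one, `p ∤ Ш_an`, pass the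
local `p`-torsion tests, and carry a generator certified `p`-indivisible in `E′(ℚ_p)` — the reach of this road
(row roads: `…FineSelmerRankOneAnchor`).

* `fineSelmerInfty_eq_bot_of_fineMordellWeil_of_local` — (FMW) + the local sockets of g6 ((T) torsion at any
  `v ∈ S`, mandatory at `v ∣ p`; or (C) the classical level-`0` tower kernel at `v ∤ p`) ⟹ `Sel₀(K_∞) = 0`,
  for EVERY number field `K`, prime `p`, `ℤ_p`-extension `κ`; `…_of_fineMordellWeil` (torsion sockets only);
  `conjA_of_fineMordellWeil[_of_local]` — (A) at `(W, p)` in the tree's `∃`-form.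
* `fineMordellWeil_of_natCard_selmerGroupPInfty_eq_one` — g6's hypothesis implies (FMW) (so this file
  generalises, and re-derives, p479853's control theorem: `fineSelmerInfty_eq_bot_of_natCard_…_of_local'`).
* `kummerMapLevel_zsmul_eq_zero_of_resH1Hom_eq_zero` — for `P ∈ E(K)` with no `D_v`-fixed `p`-th root and the
  torsion socket at `v`: a Kummer class `κ_N(n • P)` restricting to zero on (a group surjecting onto) `D_v` is zero
  (induction on `N`; `exists_fixed_root_of_resH1Hom_kummerMapLevel_eq_zero` extracts a `D_v`-fixed root).
* `fineMordellWeil_of_rankOne` — (FMW) from: `Ш(E/K)[p^∞] = ⊥`, `E(K) = ℤ·P + T` with `m·T = 0`, `p ∤ m`, the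
  socket and the indivisibility of `P` at one `v₀ ∈ S` above `p`; `fineSelmerInfty_eq_bot_of_rankOne`,
  `conjA_of_rankOne` (any `K`, any `κ`), `conjA_rat_of_rankOne` (`ℚ`, the cruxes' `∃`-form; the group law on
  `E(ℚ)` in its hypothesis is taken for the classical `DecidableEq ℚ` instance, the one `SelmerCorankProofs`'
  Kummer maps are built on).

Proof = g6's proof verbatim up to the membership `y ∈ Sel_{p^∞}(E/K_0)`, plus the local triviality of `y` on
`D_v` for `v ∈ S` above `p` (§4 `resOfLe_layerZero_inf_eq_zero` applied to the descended strict condition),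
then (FMW) in place of `#Sel = 1`; the Kummer discharge follows Greenberg §2 (pp. 62–63) / Silverman VIII.§2.
HONEST FRAMING: unconditional kernel plumbing (no named fact, no definition; only the tree's discharged
`zsmul_geomPoints_surjective_holds`, `selmerGroupOver_top`-bridge and Kummer exactness are used); per row the
rank-one anchors still need the data of record DISPLAYED (congruence, `#Ш[p^∞] = 1` or bsd.S31, the Mordell–Weil
structure, the generator's local indivisibility, the sockets); items 19386/19413 are NOT closed; class-wide the
cruxes are Coates–Sujatha (A), a named open problem. References: [GreenbergLNM1716] §2 (pp. 62–63), Prop. 3.8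
(pp. 95–96), §3 Lemmas 3.2–3.3 (pp. 86–88); [CoatesSujatha2005] §3; [SilvermanAEC2009] VIII.§2, X.§4;
[SerreGaloisCohomology1997] I.§2.6.
-/

set_option autoImplicit false
-- sibling precedent (`KatoDescentPotSupersingularAssembly.lean`): the directory name repeats the summit name
set_option linter.dupNamespace false

noncomputable section

open scoped Classical

universe u

namespace Summit.BirchSwinnertonDyer.BirchSwinnertonDyer.Theorems.FineSelmerControl

open NumberField IsDedekindDomain Field
open Literature.NumberTheory.EllipticCurves Literature.NumberTheory.EllipticCurves.GreenbergSelmer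
  Literature.NumberTheory.EllipticCurves.ZpExtension
  Literature.NumberTheory.GaloisRepresentations
  Summit.BirchSwinnertonDyer.BirchSwinnertonDyer.Theorems
  Summit.BirchSwinnertonDyer.BirchSwinnertonDyer.Theorems.FineSelmerLeSignedSelmer

section RankOneTools

variable {K : Type u} [Field K] (W : WeierstrassCurve K) {p : ℕ}

/-- **Torsion socket, `p^∞` form.** If the decomposition group `D_v` fixes no non-zero `p`-torsion
point of `E(K̄)`, it fixes no non-zero point of `E[p^∞]` (induction on the exponent).
Greenberg (1999), §3, proof of Prop. 3.8 (the hypothesis `E(F_v)[p] = 0`). [folklore] -/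
theorem geomPrimaryTorsion_eq_zero_of_forall_smul_eq (D : Subgroup (Field.absoluteGaloisGroup K))
    (hloc : ∀ x : W.geomPrimaryTorsion p, p • x = 0 → (∀ d ∈ D, d • x = x) → x = 0)
    (z : W.geomPrimaryTorsion p) (hz : ∀ d ∈ D, d • z = z) : z = 0 := by
  obtain ⟨k, hk⟩ := (AddCommGroup.mem_primaryComponent).mp z.2
  induction k generalizing z with
  | zero =>
    exact Subtype.ext (by rw [pow_zero, one_smul] at hk; exact hk)
  | succ k ih =>
    -- `p ^ k • z` is `p`-torsion and `D`-fixed, hence zero; then induct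
    have hpk : p • (p ^ k • z) = 0 := by
      apply Subtype.ext
      rw [AddSubgroupClass.coe_nsmul, AddSubgroupClass.coe_nsmul, ← mul_smul, ← pow_succ',
        ZeroMemClass.coe_zero]
      rw [pow_succ] at hk
      rw [pow_succ', ← hk, mul_comm]
    have hfix : ∀ d ∈ D, d • (p ^ k • z) = p ^ k • z := fun d hd ↦ by
      rw [smul_comm, hz d hd]
    have h0 : p ^ k • z = 0 := hloc _ hpk hfix
    exact ih z hz (by rw [← AddSubgroupClass.coe_nsmul, h0, ZeroMemClass.coe_zero])

/-- **Local root extraction.** Let `θ : L → Γ_K` be a continuous homomorphism whose image contains the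
decomposition group `D_v`, and assume the torsion socket `E[p^∞]^{D_v} = 0` (from `E(K_v)[p] = 0`).
If the level-`N` Kummer class `κ_N(R) = [σ ↦ σQ - Q]` (`p ^ N • Q = R`) restricts to zero along `θ`,
then `R` has a `D_v`-fixed `p ^ N`-th root in `E(K̄)`: the restricted cocycle is a coboundary
`σ ↦ σx - x` with `x ∈ E[p^∞]`, so `Q - x` is `D_v`-fixed, and `p ^ N • x ∈ E[p^∞]^{D_v} = 0`.
Silverman, *AEC*, VIII.§2 (Kummer pairing, local version); Greenberg (1999), §2, p. 62. [folklore] -/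
theorem exists_fixed_root_of_resH1Hom_kummerMapLevel_eq_zero [hp : Fact p.Prime] [W.IsElliptic]
    (hdiv : W.zsmul_geomPoints_surjective) (D : Subgroup (Field.absoluteGaloisGroup K))
    {L : Type u} [Group L] [TopologicalSpace L] [IsTopologicalGroup L]
    [DistribMulAction L (W.geomPrimaryTorsion p)]
    (θ : L →ₜ* Field.absoluteGaloisGroup K)
    (hθ : ∀ (l : L) (m : W.geomPrimaryTorsion p), (AddMonoidHom.id _) (θ l • m) = l • (AddMonoidHom.id _ m))
    (hD : ∀ d ∈ D, ∃ l : L, θ l = d)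
    (hloc : ∀ x : W.geomPrimaryTorsion p, p • x = 0 → (∀ d ∈ D, d • x = x) → x = 0)
    (N : ℕ) (R : W.toAffine.Point)
    (hres : resH1Hom θ (AddMonoidHom.id (W.geomPrimaryTorsion p)) hθ
        (W.kummerMapLevel p hdiv N R) = 0) :
    ∃ Q : WeierstrassCurve.geomPoints W, (∀ d ∈ D, d • Q = Q) ∧
      p ^ N • Q = WeierstrassCurve.toGeomPoints W R := by
  -- the chosen root `Q₀` and the cocycle form of `κ_N(R)`
  set Q₀ := W.kummerRoot p hdiv N R with hQ₀def
  have hQ₀ : p ^ N • Q₀ = WeierstrassCurve.toGeomPoints W R := W.nsmul_kummerRoot p hdiv N R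
  rw [W.kummerMapLevel_eq_kummerClass p hdiv N R Q₀ hQ₀] at hres
  obtain ⟨x, hx⟩ := FineSelmerLeSelmer.exists_principal_of_resH1Hom_oneCocycleClass_eq_zero θ
    (AddMonoidHom.id _) hθ Function.bijective_id (W.kummerCocycle p N Q₀ _) hres
  -- on geometric points: `θ l • Q₀ - Q₀ = θ l • x - x`
  have hx' : ∀ l : L, θ l • Q₀ - Q₀ = θ l • (x : WeierstrassCurve.geomPoints W) - x := fun l ↦ by
    have h := congrArg (fun y : W.geomPrimaryTorsion p ↦ (y : WeierstrassCurve.geomPoints W)) (hx l)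
    simp only [AddSubgroupClass.coe_sub,
      Literature.NumberTheory.EllipticCurves.primaryComponent.coe_smul] at h
    exact (W.coe_kummerCocycle_apply p N Q₀ _ (θ l)).symm.trans h
  -- `Q₁ = Q₀ - x` is `D`-fixed
  have hfix : ∀ d ∈ D, d • (Q₀ - (x : WeierstrassCurve.geomPoints W)) = Q₀ - x := fun d hd ↦ by
    obtain ⟨l, rfl⟩ := hD d hd
    rw [smul_sub, sub_eq_sub_iff_sub_eq_sub, hx' l]
  -- `p ^ N • x` is `D`-fixed, hence zero
  have hz : (p ^ N • x : W.geomPrimaryTorsion p) = 0 := by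
    refine geomPrimaryTorsion_eq_zero_of_forall_smul_eq W D hloc _ fun d hd ↦ Subtype.ext ?_
    rw [Literature.NumberTheory.EllipticCurves.primaryComponent.coe_smul, AddSubgroupClass.coe_nsmul]
    have h1 : (p ^ N • (x : WeierstrassCurve.geomPoints W)) =
        WeierstrassCurve.toGeomPoints W R - p ^ N • (Q₀ - (x : WeierstrassCurve.geomPoints W)) := by
      rw [smul_sub, hQ₀, sub_sub_cancel]
    rw [h1, smul_sub, WeierstrassCurve.smul_toGeomPoints, smul_comm, hfix d hd]
  refine ⟨Q₀ - x, hfix, ?_⟩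
  have hz' : p ^ N • (x : WeierstrassCurve.geomPoints W) = 0 := by
    rw [← AddSubgroupClass.coe_nsmul, hz, ZeroMemClass.coe_zero]
  rw [smul_sub, hz', sub_zero, hQ₀]

/-- **No `D_v`-locally-trivial multiples for a locally indivisible point.** With `θ`, the torsion socket
and a point `P ∈ E(K)` having NO `D_v`-fixed `p`-th root in `E(K̄)` (`P ∉ p · E(K_v^{alg})`): for every
`N` and every integer `n`, if `κ_N(n • P)` restricts to zero along `θ`, then `κ_N(n • P) = 0`.
Induction on `N`: for `p ∣ n` use `κ_{N+1}(p n' P) = κ_N(n' P)`; for `p ∤ n` a `D_v`-fixed root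
`p^{N+1} Q₁ = nP` and Bézout `un + wp = 1` give the `D_v`-fixed `p`-th root `u p^N Q₁ + w P` of `P`,
a contradiction. Silverman, *AEC*, VIII.§2; Greenberg (1999), §2. [folklore] -/
theorem kummerMapLevel_zsmul_eq_zero_of_resH1Hom_eq_zero [hp : Fact p.Prime] [W.IsElliptic]
    (hdiv : W.zsmul_geomPoints_surjective) (D : Subgroup (Field.absoluteGaloisGroup K))
    {L : Type u} [Group L] [TopologicalSpace L] [IsTopologicalGroup L]
    [DistribMulAction L (W.geomPrimaryTorsion p)]
    (θ : L →ₜ* Field.absoluteGaloisGroup K)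
    (hθ : ∀ (l : L) (m : W.geomPrimaryTorsion p), (AddMonoidHom.id _) (θ l • m) = l • (AddMonoidHom.id _ m))
    (hD : ∀ d ∈ D, ∃ l : L, θ l = d)
    (hloc : ∀ x : W.geomPrimaryTorsion p, p • x = 0 → (∀ d ∈ D, d • x = x) → x = 0)
    (P : W.toAffine.Point)
    (hindiv : ∀ Q : WeierstrassCurve.geomPoints W, (∀ d ∈ D, d • Q = Q) →
      p • Q ≠ WeierstrassCurve.toGeomPoints W P)
    (N : ℕ) (n : ℤ)
    (hres : resH1Hom θ (AddMonoidHom.id (W.geomPrimaryTorsion p)) hθ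
        (W.kummerMapLevel p hdiv N (n • P)) = 0) :
    W.kummerMapLevel p hdiv N (n • P) = 0 := by
  induction N generalizing n with
  | zero => exact W.kummerMapLevel_zero_level p hdiv _
  | succ N ih =>
    by_cases hpn : (p : ℤ) ∣ n
    · -- `n = p * n'`: drop one level and use the induction hypothesis
      obtain ⟨n', rfl⟩ := hpn
      have hlev : W.kummerMapLevel p hdiv (N + 1) ((↑p * n') • P) =
          W.kummerMapLevel p hdiv N (n' • P) := by
        have h := W.kummerMapLevel_level p hdiv N 1 (N + 1) rfl (n' • P)
        rw [pow_one] at h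
        rw [mul_zsmul, natCast_zsmul]
        exact h
      rw [hlev] at hres ⊢
      exact ih n' hres
    · -- `p ∤ n`: a `D`-fixed root of `n • P` of order `p^{N+1}` yields a `D`-fixed `p`-th root of `P`
      exfalso
      obtain ⟨Q₁, hQ₁, hroot⟩ := exists_fixed_root_of_resH1Hom_kummerMapLevel_eq_zero W hdiv D θ hθ
        hD hloc (N + 1) (n • P) hres
      have hcop : IsCoprime n (p : ℤ) := by
        have h1 : ¬ p ∣ n.natAbs := fun h ↦ hpn (Int.natCast_dvd.mpr h)
        rw [Int.isCoprime_iff_gcd_eq_one, Int.gcd_eq_natAbs, Int.natAbs_natCast]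
        exact Nat.Coprime.gcd_eq_one (Nat.Coprime.symm ((Nat.Prime.coprime_iff_not_dvd hp.out).mpr h1))
      obtain ⟨u, w, huw⟩ := hcop
      refine hindiv (u • ((p ^ N : ℕ) : ℤ) • Q₁ + w • WeierstrassCurve.toGeomPoints W P) ?_ ?_
      · intro d hd
        rw [smul_add, smul_comm d u, smul_comm d (((p ^ N : ℕ) : ℤ)), hQ₁ d hd, smul_comm d w,
          WeierstrassCurve.smul_toGeomPoints]
      · have hroot' : ((p ^ (N + 1) : ℕ) : ℤ) • Q₁ = n • WeierstrassCurve.toGeomPoints W P := by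
          rw [natCast_zsmul, hroot, map_zsmul]
        calc p • (u • ((p ^ N : ℕ) : ℤ) • Q₁ + w • WeierstrassCurve.toGeomPoints W P)
            = u • (((p : ℕ) : ℤ) • ((p ^ N : ℕ) : ℤ) • Q₁) +
                (w * (p : ℤ)) • WeierstrassCurve.toGeomPoints W P := by
              rw [← natCast_zsmul, smul_add, smul_comm ((p : ℕ) : ℤ) u, mul_comm w, mul_zsmul]
          _ = u • (n • WeierstrassCurve.toGeomPoints W P) +
                (w * (p : ℤ)) • WeierstrassCurve.toGeomPoints W P := by
              rw [← mul_zsmul Q₁ ((p : ℕ) : ℤ) ((p ^ N : ℕ) : ℤ), ← Nat.cast_mul, ← pow_succ', hroot']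
          _ = (u * n + w * (p : ℤ)) • WeierstrassCurve.toGeomPoints W P := by
              simp only [add_zsmul, mul_zsmul]
          _ = WeierstrassCurve.toGeomPoints W P := by rw [huw, one_zsmul]

end RankOneTools

section RankOne

variable {K : Type u} [Field K] [NumberField K] (W : WeierstrassCurve K) {p : ℕ}

/-- **(FMW) for rank-one curves with trivial `Ш[p^∞]` and a locally indivisible generator.**
Let `E/K` be an elliptic curve over a number field with `Ш(E/K)[p^∞] = 0`, `E(K) = ℤ·P ⊕ T` with
`m · T = 0`, `p ∤ m`, and let `v₀ ∈ S` be a place above `p` with `E[p^∞]^{D_{v₀}} = 0` (torsion socket)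
such that `P` has no `D_{v₀}`-fixed `p`-th root in `E(K̄)` (`P ∉ p·E(K_{v₀})`). Then every class of
`Sel_{p^∞}(E/K)` (layer `K_0 = K` of any `ℤ_p`-extension) restricting to zero on `D_v` for the
`v ∈ S` above `p` is zero — hypothesis (FMW) of `fineSelmerInfty_eq_bot_of_fineMordellWeil_of_local`.
Proof: `Sel_{p^∞}(E/K) = κ(E(K) ⊗ ℚ_p/ℤ_p)` (Kummer sequence, `Ш[p^∞] = 0`:
`range_kummerMapPInfty`, `map_primaryH1ToH1_selmerGroupPInfty`), every element is `κ_N(nP + T')`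
with `κ_N(T') = 0` (`p ∤ m`), and `κ_N(nP)|_{D_{v₀}} = 0 ⟹ κ_N(nP) = 0`
(`kummerMapLevel_zsmul_eq_zero_of_resH1Hom_eq_zero`). Greenberg (1999), §2 (Kummer sequence) and
proof of Prop. 3.8; Silverman, *AEC*, VIII.§2, X.§4. [folklore] -/
theorem fineMordellWeil_of_rankOne [hp : Fact p.Prime] [W.IsElliptic] (κ : ZpExtension K p)
    (S : Finset (HeightOneSpectrum (𝓞 K))) {v₀ : HeightOneSpectrum (𝓞 K)} (hv₀S : v₀ ∈ S)
    (hv₀p : ((p : ℕ) : 𝓞 K) ∈ v₀.asIdeal)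
    (hsha : AddCommGroup.primaryComponent W.sha p = ⊥)
    (P : W.toAffine.Point) {m : ℕ} (hm : ¬ p ∣ m)
    (hgen : ∀ R : W.toAffine.Point, ∃ (n : ℤ) (T : W.toAffine.Point), m • T = 0 ∧ R = n • P + T)
    (hindiv : ∀ Q : WeierstrassCurve.geomPoints W, (∀ d ∈ decomp v₀, d • Q = Q) →
      p • Q ≠ WeierstrassCurve.toGeomPoints W P)
    (hloc : ∀ x : W.geomPrimaryTorsion p, p • x = 0 → (∀ d ∈ decomp v₀, d • x = x) → x = 0) :
    ∀ y : W.subgroupH1 p (κ.layerSubgroup 0), y ∈ W.selmerLayer κ 0 →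
      (∀ v ∈ S, ((p : ℕ) : 𝓞 K) ∈ v.asIdeal →
        W.resOfLe p (inf_le_left : κ.layerSubgroup 0 ⊓ decomp v ≤ κ.layerSubgroup 0) y = 0) →
      y = 0 := by
  have hdiv : W.zsmul_geomPoints_surjective := W.zsmul_geomPoints_surjective_holds
  -- reduce to the subgroup `⊤` (`layerSubgroup 0 = ⊤`)
  suffices key : ∀ (H : Subgroup (absoluteGaloisGroup K)) [H.Normal], H = ⊤ →
      ∀ y : W.subgroupH1 p H, y ∈ W.selmerGroupOver p H →
        W.resOfLe p (inf_le_left : H ⊓ decomp v₀ ≤ H) y = 0 → y = 0 by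
    exact fun y hy hyv ↦ key (κ.layerSubgroup 0) κ.layerSubgroup_zero y hy (hyv v₀ hv₀S hv₀p)
  rintro H _ rfl y hy hyv
  -- `y = res c` for a class `c ∈ H¹(K, E[p^∞])`, which is Selmer
  obtain ⟨c, rfl⟩ :=
    (bijective_resH1Hom_subgroupIncl (W.geomPrimaryTorsion p) ⊤ Subgroup.mem_top).2 y
  have hc : c ∈ W.selmerGroupPInfty p :=
    (W.resH1Hom_subgroupIncl_mem_selmerGroupOver_top_iff p c).mp hy
  -- `Ш[p^∞] = 0`: `c` is a Kummer class `κ_N(R)`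
  have hker : c ∈ (W.primaryH1ToH1 p).ker := by
    have h : W.primaryH1ToH1 p c ∈ (W.selmerGroupPInfty p).map (W.primaryH1ToH1 p) := ⟨c, hc, rfl⟩
    rw [W.map_primaryH1ToH1_selmerGroupPInfty p hdiv, hsha, AddSubgroup.map_bot] at h
    exact (AddMonoidHom.mem_ker).mpr ((AddSubgroup.mem_bot).mp h)
  rw [← W.range_kummerMapPInfty p hdiv] at hker
  obtain ⟨t, rfl⟩ := hker
  obtain ⟨R, N, rfl⟩ := W.exists_eq_tmul_prufGen p t
  rw [W.kummerMapPInfty_tmul_prufGen p hdiv] at hyv ⊢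
  -- `R = n • P + T` with `m • T = 0`: the torsion part has trivial Kummer class (`p ∤ m`)
  obtain ⟨n, T, hT, rfl⟩ := hgen R
  have hT0 : W.kummerMapLevel p hdiv N T = 0 := by
    refine eq_zero_of_nsmul_eq_zero_of_coprime
      (Nat.Coprime.pow_right N (Nat.Coprime.symm ((Nat.Prime.coprime_iff_not_dvd hp.out).mpr hm)))
      ?_ ?_
    · rw [← map_nsmul, hT, map_zero]
    · rw [← map_nsmul]
      exact W.kummerMapLevel_nsmul_self p hdiv N T
  rw [map_add, hT0, add_zero] at hyv ⊢
  -- the restriction of `κ_N(n • P)` to `⊤ ⊓ D_{v₀}` vanishes; conclude by the Kummer induction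
  let θ : ↥((⊤ : Subgroup (absoluteGaloisGroup K)) ⊓ decomp v₀) →ₜ* absoluteGaloisGroup K :=
    (Literature.NumberTheory.EllipticCurves.subgroupIncl (⊤ : Subgroup (absoluteGaloisGroup K))).comp
      (subgroupInclusion inf_le_left)
  have hres : resH1Hom θ (AddMonoidHom.id (W.geomPrimaryTorsion p)) (fun _ _ ↦ rfl)
      (W.kummerMapLevel p hdiv N (n • P)) = 0 := by
    have h : resH1Hom (subgroupInclusion
          (inf_le_left : (⊤ : Subgroup (absoluteGaloisGroup K)) ⊓ decomp v₀ ≤ ⊤))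
        (AddMonoidHom.id (W.geomPrimaryTorsion p)) (fun _ _ ↦ rfl)
        (resH1Hom (Literature.NumberTheory.EllipticCurves.subgroupIncl (⊤ : Subgroup (absoluteGaloisGroup K)))
          (AddMonoidHom.id (W.geomPrimaryTorsion p)) (fun _ _ ↦ rfl)
          (W.kummerMapLevel p hdiv N (n • P))) = 0 := hyv
    rw [resH1Hom_resH1Hom] at h
    exact h
  have hD : ∀ d ∈ decomp v₀, ∃ l : ↥((⊤ : Subgroup (absoluteGaloisGroup K)) ⊓ decomp v₀), θ l = d :=
    fun d hd ↦ ⟨⟨d, Subgroup.mem_inf.mpr ⟨Subgroup.mem_top d, hd⟩⟩, rfl⟩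
  have h0 := kummerMapLevel_zsmul_eq_zero_of_resH1Hom_eq_zero W hdiv (decomp v₀) θ (fun _ _ ↦ rfl)
    hD hloc P hindiv N n hres
  rw [h0, map_zero]

/-- `Nat.card`-form of the `Ш`-hypothesis: `#Ш(E/K)[p^∞] = 1 ⟹ Ш(E/K)[p^∞] = ⊥`. [folklore] -/
theorem primaryComponent_sha_eq_bot_of_natCard_eq_one
    (h : Nat.card (AddCommGroup.primaryComponent W.sha p) = 1) :
    AddCommGroup.primaryComponent W.sha p = ⊥ :=
  AddSubgroup.eq_bot_of_card_eq _ h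

end RankOne

section RankOneConjA

variable {K : Type u} [Field K] [NumberField K] (W : WeierstrassCurve K) {p : ℕ} [hp : Fact p.Prime]
  (κ : ZpExtension K p)

/-- **`Sel₀(K_∞, E[p^∞]) = 0` for a RANK-ONE curve** with `#Ш(E/K)[p^∞] = 1`, `E(K) = ℤ·P ⊕ T` (`m·T = 0`,
`p ∤ m`), torsion sockets `E[p^∞]^{D_v} = 0` on a finite set `S ∋ v₀ ∣ p` off which `E` is good and
`v ∤ p`, and `P` with no `D_{v₀}`-fixed `p`-th root (`P ∉ p·E(K_{v₀})`); any `ℤ_p`-extension, no reduction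
hypothesis at `p`. (`fineMordellWeil_of_rankOne` + `fineSelmerInfty_eq_bot_of_fineMordellWeil`.)
[cite: GreenbergLNM1716, Prop. 3.8 (pp. 95–96) and §2 (Kummer sequence)] -/
theorem fineSelmerInfty_eq_bot_of_rankOne [W.IsElliptic] (S : Finset (HeightOneSpectrum (𝓞 K)))
    (hS : ∀ v ∉ S, ((p : ℕ) : 𝓞 K) ∉ v.asIdeal ∧ W.HasGoodReductionAt v)
    {v₀ : HeightOneSpectrum (𝓞 K)} (hv₀S : v₀ ∈ S) (hv₀p : ((p : ℕ) : 𝓞 K) ∈ v₀.asIdeal)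
    (hsha : Nat.card (AddCommGroup.primaryComponent W.sha p) = 1)
    (P : W.toAffine.Point) {m : ℕ} (hm : ¬ p ∣ m)
    (hgen : ∀ R : W.toAffine.Point, ∃ (n : ℤ) (T : W.toAffine.Point), m • T = 0 ∧ R = n • P + T)
    (hindiv : ∀ Q : WeierstrassCurve.geomPoints W, (∀ d ∈ decomp v₀, d • Q = Q) →
      p • Q ≠ WeierstrassCurve.toGeomPoints W P)
    (hloc : ∀ v ∈ S, ∀ x : W.geomPrimaryTorsion p, p • x = 0 → (∀ d ∈ decomp v, d • x = x) → x = 0) :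
    W.fineSelmerInfty κ = ⊥ :=
  fineSelmerInfty_eq_bot_of_fineMordellWeil W κ S hS
    (fineMordellWeil_of_rankOne W κ S hv₀S hv₀p (primaryComponent_sha_eq_bot_of_natCard_eq_one W hsha)
      P hm hgen hindiv (hloc v₀ hv₀S)) hloc

/-- **(A) at `(E, p)` for a RANK-ONE curve** (same data; the tree's `∃`-form, any `ℤ_p`-extension): the
Pontryagin dual of `Sel₀(K_∞, E[p^∞])` is finitely generated over `ℤ_p` — indeed zero.
[cite: CoatesSujatha2005, §3 (Conjecture A)] [cite: GreenbergLNM1716, Prop. 3.8 (pp. 95–96)] -/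
theorem conjA_of_rankOne [W.IsElliptic] (S : Finset (HeightOneSpectrum (𝓞 K)))
    (hS : ∀ v ∉ S, ((p : ℕ) : 𝓞 K) ∉ v.asIdeal ∧ W.HasGoodReductionAt v)
    {v₀ : HeightOneSpectrum (𝓞 K)} (hv₀S : v₀ ∈ S) (hv₀p : ((p : ℕ) : 𝓞 K) ∈ v₀.asIdeal)
    (hsha : Nat.card (AddCommGroup.primaryComponent W.sha p) = 1)
    (P : W.toAffine.Point) {m : ℕ} (hm : ¬ p ∣ m)
    (hgen : ∀ R : W.toAffine.Point, ∃ (n : ℤ) (T : W.toAffine.Point), m • T = 0 ∧ R = n • P + T)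
    (hindiv : ∀ Q : WeierstrassCurve.geomPoints W, (∀ d ∈ decomp v₀, d • Q = Q) →
      p • Q ≠ WeierstrassCurve.toGeomPoints W P)
    (hloc : ∀ v ∈ S, ∀ x : W.geomPrimaryTorsion p, p • x = 0 → (∀ d ∈ decomp v, d • x = x) → x = 0) :
    ∃ (γ : absoluteGaloisGroup K) (D : W.FineSelmerDualData κ γ),
      Module.Finite ℤ_[p] (RestrictScalars ℤ_[p] (IwasawaAlgebra p) D.X) :=
  conjA_of_fineMordellWeil W κ S hS
    (fineMordellWeil_of_rankOne W κ S hv₀S hv₀p (primaryComponent_sha_eq_bot_of_natCard_eq_one W hsha)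
      P hm hgen hindiv (hloc v₀ hv₀S)) hloc

end RankOneConjA

section RankOneRat

/-- **(A) at `(E, p)` over `ℚ` for every cyclotomic `κ` from RANK-ONE anchor data**, in the exact `∃`-form of
the cruxes and of the Lim–Sujatha transfer: `#Ш(E/ℚ)[p^∞] = 1`, `E(ℚ) = ℤ·P ⊕ T` with `m·T = 0`, `p ∤ m`,
torsion sockets on `S = {p} ∪ bad(E)`, and `P ∉ p·E(ℚ_p)` (no `D_p`-fixed `p`-th root). (Holds for every
`ℤ_p`-extension; the cyclotomic hypothesis is not used.) [cite: CoatesSujatha2005, §3 (Conjecture A)]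
[cite: GreenbergLNM1716, Prop. 3.8 (pp. 95–96)] -/
theorem conjA_rat_of_rankOne (W : WeierstrassCurve ℚ) [W.IsElliptic] {p : ℕ} [Fact p.Prime]
    (S : Finset (HeightOneSpectrum (𝓞 ℚ)))
    (hS : ∀ v ∉ S, ((p : ℕ) : 𝓞 ℚ) ∉ v.asIdeal ∧ W.HasGoodReductionAt v)
    {v₀ : HeightOneSpectrum (𝓞 ℚ)} (hv₀S : v₀ ∈ S) (hv₀p : ((p : ℕ) : 𝓞 ℚ) ∈ v₀.asIdeal)
    (hsha : Nat.card (AddCommGroup.primaryComponent W.sha p) = 1)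
    (P : W.toAffine.Point) {m : ℕ} (hm : ¬ p ∣ m)
    (hgen : letI := Classical.decEq ℚ
      ∀ R : W.toAffine.Point, ∃ (n : ℤ) (T : W.toAffine.Point), m • T = 0 ∧ R = n • P + T)
    (hindiv : ∀ Q : WeierstrassCurve.geomPoints W, (∀ d ∈ decomp v₀, d • Q = Q) →
      p • Q ≠ WeierstrassCurve.toGeomPoints W P)
    (hloc : ∀ v ∈ S, ∀ x : W.geomPrimaryTorsion p, p • x = 0 → (∀ d ∈ decomp v, d • x = x) → x = 0) :
    ∀ (κ : ZpExtension ℚ p), κ.IsCyclotomic →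
      ∃ (γ : absoluteGaloisGroup ℚ) (D : W.FineSelmerDualData κ γ),
        Module.Finite ℤ_[p] (RestrictScalars ℤ_[p] (IwasawaAlgebra p) D.X) :=
  fun κ _ ↦ conjA_of_rankOne W κ S hS hv₀S hv₀p hsha P hm hgen hindiv hloc

end RankOneRat

end Summit.BirchSwinnertonDyer.BirchSwinnertonDyer.Theorems.FineSelmerControl

end
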